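import Literature.Barriers.CriticalPhenomena.PlaquetteWalkHoleRootCutDeadEnds
import Literature.Barriers.CriticalPhenomena.PlaquetteWalkHoleRootCutSigns
import HarnessLib

/-!
# Barrier catalogue (SAWScalingLimit): SEALED DOORS — a far door that is a dead end, or a sealed root plaquette, kills BOTH routes
and the vertex functional, in EVERY domain

Leaf of `PlaquetteWalkHoleRootCutDeadEnds` (★ `ΩG.nth_ne_side_of_deadEnd`: the one door of a dead-end cell is never a mid-edge of a
class-`B2a` walk to the far cell) and `PlaquetteWalkHoleRootCutSigns` (cone: `PlaquetteWalkHoleRootFarCellLaw` — the three-door law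
`ΩG.doors_of_wound_far`, `ΩG.firstSide_eq_N_or_S_of_WE_ne`, `ΩG.exit_return_doors`; `PlaquetteWalkHoleRootOneRouteSigns` —
`vertexFunctional_printed_eq_zero_of_both_unwound`). Setting: root plaquette `w` rooted at `W`, hole `holeFaceW w ∉ D`, far cell
`farW w = (w.1 − 2, w.2)` with its three doors `farSW w = (w.1 − 2, w.2 − 1)` (south), `farNW w` (north), `farWW w` (west).

The venture lane's «ANY TRIPLE» theorems (b-step0 gen 30, `PlaquetteWalkHoleRootAnyTriple*`) exclude four PORT TRIPLES of removed
cells — the three outer neighbours of a far door, or the three neighbours of the root plaquette — and the kit completeness scan shows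
these are the only exceptions five cells from the walls. This file proves that they ARE exceptions, locally (no wall, any further
defects): each seals a cell that every wound walk must cross.

* §1 ★★★ `ΩG.exists_nth_eq_farW_side_of_wound` — a WOUND class-`B2a` walk at the far cell crosses EACH of the three far doors: for every
  side `s ≠ E` of the far cell some mid-edge `nth i` (`1 ≤ i ≤ length`) is `(farW w).side s` (first side ∈ {N, S}, exit and return sides
  are the two others: the three-door law with the indices made explicit); ★★★ `ΩG.WE_eq_excursionWinding_of_farW_side_uncrossed` — so a
  far door that NO class-`B2a` walk can cross kills both routes.
* §2 ★★★★ THE DEAD-END DOORS: `ΩG.WE_eq_excursionWinding_of_farSW_deadEnd` — `(w.1 − 3, w.2 − 1)`, `(w.1 − 2, w.2 − 2)`, `(w.1 − 1, w.2 − 1)`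
  absent (the port triple of `farS`: `pocketSW`, `farSWS`, `holeS`) ⇒ NO wound walk of either route; `…_of_farNW_deadEnd` (port triple of
  `farN`), `…_of_farWW_deadEnd` (`(w.1 − 4, w.2)`, `pocketSW`, `pocketNW` absent); ★★★★ `ΩG.false_of_rootSealed` — `rootS`, `rootN`, `rootE`
  absent ⇒ there is NO class-`B2a` walk at the far cell at all (the first arc leaves the root plaquette through a door).
* §3 ★★★ the vertex functional: `vertexFunctional_printed_eq_zero_of_farSW_deadEnd` / `…farNW…` / `…farWW…` / `…_of_rootSealed` —
  `V(θ) = 0` on `[π/3, 2π/3]` for every face list with the far cell present, the hole absent and one of the four port triples absent: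
  four identically-vanishing configurations that need no wall (the second local species after the closed far door of
  `PlaquetteWalkHoleRootFarCellLaw`).

Not in print; venture lane «pcv-sawmu», seat b-step0 gen 30.

References: A. Glazman, Electron. Commun. Probab. 20 (2015) no. 86, Lemma 3.1, proof pp. 6–7 (the classes of walks through a rhombus)
[Glazman2015WeightedSAW]; A. Glazman, I. Manolescu, arXiv:1708.00395v3, §1 (Fig. 1), §2.1, Lemma 2.1 [GlazmanManolescu2019].
-/

noncomputable section

open Set Function Complex

namespace Literature.Probability.RandomPlanarGeometry.SAW.YangBaxter

open Real

open private nth_firstHitG exitSide_specG from Literature.Probability.RandomPlanarGeometry.YangBaxterSAWGeneralDomain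

namespace ΩG

variable {D : Set Face} {w : Face}

/-! ## §1 A wound walk crosses each far door -/

/-- Side bookkeeping: three pairwise distinct sides, the first in `{N, S}`, the others not `E`, contain any given side `s ≠ E`. [folklore]
[cite: GlazmanManolescu2019, §1, Fig. 4 (the four sides of a rhombus)] -/
private theorem three_sides_cover {z0 z1 z2 s : Side} (h0 : z0 = .N ∨ z0 = .S) (h01 : z0 ≠ z1) (h02 : z0 ≠ z2) (h12 : z1 ≠ z2)
    (h1E : z1 ≠ .E) (h2E : z2 ≠ .E) (hs : s ≠ .E) : s = z0 ∨ s = z1 ∨ s = z2 := by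
  rcases h0 with rfl | rfl <;> cases z1 <;> cases z2 <;> cases s <;> simp_all

/-- ★★★ **A WOUND WALK CROSSES EACH FAR DOOR.** Hole absent; `ω` a class-`B2a` walk at the far cell, wound at `θ`. Then for every side
`s ≠ E` of the far cell some mid-edge of the walk with index `1 ≤ i ≤ length` is `(farW w).side s`: the first side (∈ `{N, S}` for a wound
walk), the exit side and the return side are three pairwise distinct sides other than `E`.
[cite: Glazman2015WeightedSAW, Lemma 3.1 (proof, pp. 6–7: the classes of walks through a rhombus)] [cite: GlazmanManolescu2019, Lemma 2.1] -/
theorem exists_nth_eq_farW_side_of_wound (hh : holeFaceW w ∉ D) (ω : ΩG D (w.side .W) (farW w))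
    (hr : RootedFace D (w.side .W) (farW w)) (h : ω.IsB2a) {θ : ℝ}
    (hW : ω.WE (fun _ => θ) ≠ excursionWinding θ ω.2.firstSideG (ω.z1 hr h) ω.1) {s : Side} (hs : s ≠ .E) :
    ∃ i, 1 ≤ i ∧ i ≤ ω.2.arcs.length ∧ ω.2.nth i = (farW w).side s := by
  have hB2 : ω.2.firstHitG + 1 < ω.2.arcs.length := h.1
  obtain ⟨hz01, hz02, hz12⟩ := ω.firstSide_exit_return_distinct hr h
  have hdoors := ω.exit_return_doors hr h
  have hz0 := firstSide_eq_N_or_S_of_WE_ne hh ω hr h hW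
  have h1E : ω.z1 hr h ≠ .E := by
    intro e; rw [e, farW_side_E_faces] at hdoors; exact hh hdoors.1.2
  have h2E : ω.1 ≠ .E := by
    intro e; rw [e, farW_side_E_faces] at hdoors; exact hh hdoors.2.2
  rcases three_sides_cover hz0 hz01 hz02 hz12 h1E h2E hs with e | e | e
  · exact ⟨ω.2.firstHitG, ω.one_le_firstHitG_far, by omega, by rw [e]; exact nth_firstHitG ω.2⟩
  · refine ⟨ω.2.firstHitG + 1, by omega, by omega, ?_⟩
    rw [e]; exact (ω.2.exitSide_specG hr (by omega)).1
  · exact ⟨ω.2.arcs.length, by omega, le_rfl, by rw [e, ω.2.nth_length]⟩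

/-- ★★★ **AN UNCROSSABLE FAR DOOR KILLS BOTH ROUTES.** If no mid-edge of `ω` (indices `1 ≤ i ≤ length`) is the side `s ≠ E` of the far
cell, then `ω` is not wound. [cite: Glazman2015WeightedSAW, Lemma 3.1 (proof, pp. 6–7)] [cite: GlazmanManolescu2019, Lemma 2.1] -/
theorem WE_eq_excursionWinding_of_farW_side_uncrossed (hh : holeFaceW w ∉ D) (ω : ΩG D (w.side .W) (farW w))
    (hr : RootedFace D (w.side .W) (farW w)) (h : ω.IsB2a) {s : Side} (hs : s ≠ .E)
    (hun : ∀ i, 1 ≤ i → i ≤ ω.2.arcs.length → ω.2.nth i ≠ (farW w).side s) (θ : ℝ) :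
    ω.WE (fun _ => θ) = excursionWinding θ ω.2.firstSideG (ω.z1 hr h) ω.1 := by
  by_contra hW
  obtain ⟨i, hi1, hi2, e⟩ := exists_nth_eq_farW_side_of_wound hh ω hr h hW hs
  exact hun i hi1 hi2 e

/-! ## §2 The dead-end doors and the sealed root plaquette -/

/-- ★★★★ **`farS` A DEAD END ⇒ NO WOUND WALK OF EITHER ROUTE.** Hole absent; the three outer neighbours `(w.1 − 3, w.2 − 1)` (`pocketSW`),
`(w.1 − 2, w.2 − 2)` (`farSWS`) and `(w.1 − 1, w.2 − 1)` (`holeS`) of `farSW w = (w.1 − 2, w.2 − 1)` absent. Then the far cell's south door is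
the only door of a dead end, no class-`B2a` walk crosses it (`nth_ne_side_of_deadEnd`), and no such walk is wound — whatever else `D` is.
[cite: Glazman2015WeightedSAW, Lemma 3.1 (proof, pp. 6–7)] [cite: GlazmanManolescu2019, §1 (Fig. 1), Lemma 2.1] -/
theorem WE_eq_excursionWinding_of_farSW_deadEnd (hh : holeFaceW w ∉ D) (hP : ((w.1 - 3, w.2 - 1) : Face) ∉ D)
    (hF : ((w.1 - 2, w.2 - 2) : Face) ∉ D) (hH : ((w.1 - 1, w.2 - 1) : Face) ∉ D)
    (ω : ΩG D (w.side .W) (farW w)) (hr : RootedFace D (w.side .W) (farW w)) (h : ω.IsB2a) (θ : ℝ) :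
    ω.WE (fun _ => θ) = excursionWinding θ ω.2.firstSideG (ω.z1 hr h) ω.1 := by
  have e : (farW w).side .S = (farSW w).side .N := by
    obtain ⟨a, b⟩ := w; simp only [farW, farSW, Face.side]; congr 1; ring
  refine WE_eq_excursionWinding_of_farW_side_uncrossed hh ω hr h (s := .S) (by decide) (fun i hi1 hi2 => ?_) θ
  rw [e]
  refine nth_ne_side_of_deadEnd hh hr h (g := farSW w) ?_ ?_ (fun t ht => ?_) i hi1 hi2
  · obtain ⟨a, b⟩ := w; simp [farSW, Prod.ext_iff]
  · obtain ⟨a, b⟩ := w; simp [farSW, farW, Prod.ext_iff]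
  · obtain ⟨a, b⟩ := w
    cases t
    · left; simpa [farSW, Face.side, MidEdge.faces, show a - 2 - 1 = a - 3 by ring] using hP
    · right; simpa [farSW, Face.side, MidEdge.faces, show a - 2 + 1 = a - 1 by ring] using hH
    · left; simpa [farSW, Face.side, MidEdge.faces, show b - 1 - 1 = b - 2 by ring] using hF
    · exact absurd rfl ht

/-- ★★★★ **`farN` A DEAD END ⇒ NO WOUND WALK OF EITHER ROUTE**: `(w.1 − 3, w.2 + 1)` (`pocketNW`), `(w.1 − 2, w.2 + 2)` (`farNWN`) and
`(w.1 − 1, w.2 + 1)` (`holeN`) absent. [cite: Glazman2015WeightedSAW, Lemma 3.1 (proof, pp. 6–7)] [cite: GlazmanManolescu2019, §1 (Fig. 1), Lemma 2.1] -/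
theorem WE_eq_excursionWinding_of_farNW_deadEnd (hh : holeFaceW w ∉ D) (hP : ((w.1 - 3, w.2 + 1) : Face) ∉ D)
    (hF : ((w.1 - 2, w.2 + 2) : Face) ∉ D) (hH : ((w.1 - 1, w.2 + 1) : Face) ∉ D)
    (ω : ΩG D (w.side .W) (farW w)) (hr : RootedFace D (w.side .W) (farW w)) (h : ω.IsB2a) (θ : ℝ) :
    ω.WE (fun _ => θ) = excursionWinding θ ω.2.firstSideG (ω.z1 hr h) ω.1 := by
  have e : (farW w).side .N = Face.side ((w.1 - 2, w.2 + 1) : Face) .S := by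
    obtain ⟨a, b⟩ := w; simp only [farW, Face.side]
  refine WE_eq_excursionWinding_of_farW_side_uncrossed hh ω hr h (s := .N) (by decide) (fun i hi1 hi2 => ?_) θ
  rw [e]
  refine nth_ne_side_of_deadEnd hh hr h (g := ((w.1 - 2, w.2 + 1) : Face)) ?_ ?_ (fun t ht => ?_) i hi1 hi2
  · obtain ⟨a, b⟩ := w; simp [Prod.ext_iff]
  · obtain ⟨a, b⟩ := w; simp [farW, Prod.ext_iff]
  · obtain ⟨a, b⟩ := w
    cases t
    · left; simpa [Face.side, MidEdge.faces, show a - 2 - 1 = a - 3 by ring] using hP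
    · right; simpa [Face.side, MidEdge.faces, show a - 2 + 1 = a - 1 by ring] using hH
    · exact absurd rfl ht
    · right; simpa [Face.side, MidEdge.faces, show b + 1 + 1 = b + 2 by ring] using hF

/-- ★★★★ **`farWW` A DEAD END ⇒ NO WOUND WALK OF EITHER ROUTE**: `(w.1 − 4, w.2)`, `(w.1 − 3, w.2 − 1)` (`pocketSW`) and `(w.1 − 3, w.2 + 1)`
(`pocketNW`) absent. [cite: Glazman2015WeightedSAW, Lemma 3.1 (proof, pp. 6–7)] [cite: GlazmanManolescu2019, §1 (Fig. 1), Lemma 2.1] -/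
theorem WE_eq_excursionWinding_of_farWW_deadEnd (hh : holeFaceW w ∉ D) (hO : ((w.1 - 4, w.2) : Face) ∉ D)
    (hS : ((w.1 - 3, w.2 - 1) : Face) ∉ D) (hN : ((w.1 - 3, w.2 + 1) : Face) ∉ D)
    (ω : ΩG D (w.side .W) (farW w)) (hr : RootedFace D (w.side .W) (farW w)) (h : ω.IsB2a) (θ : ℝ) :
    ω.WE (fun _ => θ) = excursionWinding θ ω.2.firstSideG (ω.z1 hr h) ω.1 := by
  have e : (farW w).side .W = Face.side ((w.1 - 3, w.2) : Face) .E := by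
    obtain ⟨a, b⟩ := w; simp only [farW, Face.side]; congr 1; ring
  refine WE_eq_excursionWinding_of_farW_side_uncrossed hh ω hr h (s := .W) (by decide) (fun i hi1 hi2 => ?_) θ
  rw [e]
  refine nth_ne_side_of_deadEnd hh hr h (g := ((w.1 - 3, w.2) : Face)) ?_ ?_ (fun t ht => ?_) i hi1 hi2
  · obtain ⟨a, b⟩ := w; simp [Prod.ext_iff]
  · obtain ⟨a, b⟩ := w; simp [farW, Prod.ext_iff]
  · obtain ⟨a, b⟩ := w
    cases t
    · left; simpa [Face.side, MidEdge.faces, show a - 3 - 1 = a - 4 by ring] using hO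
    · exact absurd rfl ht
    · left; simpa [Face.side, MidEdge.faces] using hS
    · right; simpa [Face.side, MidEdge.faces] using hN

/-- ★★★★ **THE ROOT PLAQUETTE SEALED ⇒ NO CLASS-`B2a` WALK AT ALL.** Hole, `rootS w = (w.1, w.2 − 1)`, `rootN w = (w.1, w.2 + 1)` and
`rootE = (w.1 + 1, w.2)` absent: the first arc of a walk from the root edge lies in `w` (`fc_zero_eq_root`) and leaves it through a side whose
other face is one of the three — a door of the walk (`door_nth`), contradiction.
[cite: Glazman2015WeightedSAW, Lemma 3.1 (proof, pp. 6–7)] [cite: GlazmanManolescu2019, §1 (Fig. 1: an arc joins two sides of its rhombus)] -/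
theorem false_of_rootSealed (hh : holeFaceW w ∉ D) (hS : rootS w ∉ D) (hN : rootN w ∉ D) (hE : ((w.1 + 1, w.2) : Face) ∉ D)
    (ω : ΩG D (w.side .W) (farW w)) (h : ω.IsB2a) : False := by
  have hB2 : ω.2.firstHitG + 1 < ω.2.arcs.length := h.1
  have h0 : 0 < ω.2.arcs.length := by omega
  have hfc := fc_zero_eq_root (w := w) hh ω.2 h0
  obtain ⟨hin, hout, hio⟩ := ω.2.side_sIn_nth (i := 0) h0
  rw [hfc] at hin hout
  rw [ω.2.nth_zero] at hin
  have hsin : ω.2.sIn 0 = .W := (Face.side_injective w (hin.symm)).symm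
  have hd := ω.2.door_nth (j := 1) (by omega) (by omega)
  rw [show (0 : ℕ) + 1 = 1 from rfl] at hout
  rw [← hout] at hd
  have hne : ω.2.sOut 0 ≠ .W := fun e2 => hio (hsin.trans e2.symm)
  obtain ⟨a, b⟩ := w
  cases hso : ω.2.sOut 0
  · exact hne hso
  · rw [hso] at hd; simp [Face.side, MidEdge.faces] at hd; exact hE hd.2
  · rw [hso] at hd; simp [Face.side, MidEdge.faces, rootS] at hd hS; exact hS hd.1
  · rw [hso] at hd; simp [Face.side, MidEdge.faces, rootN] at hd hN; exact hN hd.2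

/-- …hence, vacuously, every class-`B2a` walk at the far cell of a sealed root plaquette is unwound.
[cite: Glazman2015WeightedSAW, Lemma 3.1 (proof, pp. 6–7)] [cite: GlazmanManolescu2019, Lemma 2.1] -/
theorem WE_eq_excursionWinding_of_rootSealed (hh : holeFaceW w ∉ D) (hS : rootS w ∉ D) (hN : rootN w ∉ D)
    (hE : ((w.1 + 1, w.2) : Face) ∉ D)
    (ω : ΩG D (w.side .W) (farW w)) (hr : RootedFace D (w.side .W) (farW w)) (h : ω.IsB2a) (θ : ℝ) :
    ω.WE (fun _ => θ) = excursionWinding θ ω.2.firstSideG (ω.z1 hr h) ω.1 :=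
  (false_of_rootSealed hh hS hN hE ω h).elim

end ΩG

end Literature.Probability.RandomPlanarGeometry.SAW.YangBaxter

namespace Literature.Barriers.CriticalPhenomena.PlaquetteWalk

open Literature.Probability.RandomPlanarGeometry.SAW.YangBaxter
open Real Complex

/-! ## §3 The vertex functional: four identically-vanishing local configurations -/

section SealedVF

variable {Dl : List Face} {w : Face}

/-- ★★★ **`farS` A DEAD END ⇒ `V ≡ 0`.** Far cell present, hole absent, the three outer neighbours of `farSW w` absent ⇒ the Yang–Baxter vertex
functional with the printed weights vanishes at every `θ ∈ [π/3, 2π/3]`, in every domain.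
[cite: GlazmanManolescu2019, Lemma 2.1 (statement, "in the form given in [Gl]"), §1 eq. (1)] [cite: Glazman2015WeightedSAW, Lemma 3.1 (proof, pp. 6–7)] -/
theorem vertexFunctional_printed_eq_zero_of_farSW_deadEnd {θ : ℝ} (hθ : θ ∈ Set.Icc (π / 3) (2 * π / 3))
    (hf : farW w ∈ Dl) (hh : holeFaceW w ∉ dom Dl) (hP : ((w.1 - 3, w.2 - 1) : Face) ∉ dom Dl)
    (hF : ((w.1 - 2, w.2 - 2) : Face) ∉ dom Dl) (hH : ((w.1 - 1, w.2 - 1) : Face) ∉ dom Dl) :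
    vertexFunctional (printedWeights θ) tFiveEighths (ybCoeff θ) Dl (w.side .W) (farW w) = 0 :=
  vertexFunctional_printed_eq_zero_of_both_unwound hθ hf hh fun hr ω h =>
    ΩG.WE_eq_excursionWinding_of_farSW_deadEnd hh hP hF hH ω hr h θ

/-- ★★★ **`farN` A DEAD END ⇒ `V ≡ 0`.** [cite: GlazmanManolescu2019, Lemma 2.1 (statement, "in the form given in [Gl]"), §1 eq. (1)]
[cite: Glazman2015WeightedSAW, Lemma 3.1 (proof, pp. 6–7)] -/
theorem vertexFunctional_printed_eq_zero_of_farNW_deadEnd {θ : ℝ} (hθ : θ ∈ Set.Icc (π / 3) (2 * π / 3))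
    (hf : farW w ∈ Dl) (hh : holeFaceW w ∉ dom Dl) (hP : ((w.1 - 3, w.2 + 1) : Face) ∉ dom Dl)
    (hF : ((w.1 - 2, w.2 + 2) : Face) ∉ dom Dl) (hH : ((w.1 - 1, w.2 + 1) : Face) ∉ dom Dl) :
    vertexFunctional (printedWeights θ) tFiveEighths (ybCoeff θ) Dl (w.side .W) (farW w) = 0 :=
  vertexFunctional_printed_eq_zero_of_both_unwound hθ hf hh fun hr ω h =>
    ΩG.WE_eq_excursionWinding_of_farNW_deadEnd hh hP hF hH ω hr h θ

/-- ★★★ **`farWW` A DEAD END ⇒ `V ≡ 0`.** [cite: GlazmanManolescu2019, Lemma 2.1 (statement, "in the form given in [Gl]"), §1 eq. (1)]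
[cite: Glazman2015WeightedSAW, Lemma 3.1 (proof, pp. 6–7)] -/
theorem vertexFunctional_printed_eq_zero_of_farWW_deadEnd {θ : ℝ} (hθ : θ ∈ Set.Icc (π / 3) (2 * π / 3))
    (hf : farW w ∈ Dl) (hh : holeFaceW w ∉ dom Dl) (hO : ((w.1 - 4, w.2) : Face) ∉ dom Dl)
    (hS : ((w.1 - 3, w.2 - 1) : Face) ∉ dom Dl) (hN : ((w.1 - 3, w.2 + 1) : Face) ∉ dom Dl) :
    vertexFunctional (printedWeights θ) tFiveEighths (ybCoeff θ) Dl (w.side .W) (farW w) = 0 :=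
  vertexFunctional_printed_eq_zero_of_both_unwound hθ hf hh fun hr ω h =>
    ΩG.WE_eq_excursionWinding_of_farWW_deadEnd hh hO hS hN ω hr h θ

/-- ★★★ **ROOT PLAQUETTE SEALED ⇒ `V ≡ 0`** (`rootS`, `rootN`, `rootE` absent; no class-`B2a` walk exists).
[cite: GlazmanManolescu2019, Lemma 2.1 (statement, "in the form given in [Gl]"), §1 eq. (1)] [cite: Glazman2015WeightedSAW, Lemma 3.1 (proof, pp. 6–7)] -/
theorem vertexFunctional_printed_eq_zero_of_rootSealed {θ : ℝ} (hθ : θ ∈ Set.Icc (π / 3) (2 * π / 3))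
    (hf : farW w ∈ Dl) (hh : holeFaceW w ∉ dom Dl) (hS : rootS w ∉ dom Dl) (hN : rootN w ∉ dom Dl)
    (hE : ((w.1 + 1, w.2) : Face) ∉ dom Dl) :
    vertexFunctional (printedWeights θ) tFiveEighths (ybCoeff θ) Dl (w.side .W) (farW w) = 0 :=
  vertexFunctional_printed_eq_zero_of_both_unwound hθ hf hh fun hr ω h =>
    ΩG.WE_eq_excursionWinding_of_rootSealed hh hS hN hE ω hr h θ

end SealedVF

end Literature.Barriers.CriticalPhenomena.PlaquetteWalk
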